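/-
Copyright: lit-balaban Phase-2 proof seat p29 (gen 30).  Statement-level skeleton of a published paper; no proof claims beyond what the
kernel checks below.
-/
import Literature.MathematicalPhysics.QuantumFieldTheory.BalabanImbrieJaffe1984to88.BIJ88Close231WholeTorusFlatCwt

/-!
# `BalabanImbrieJaffe1984to88.BIJ88LocDeriv231TorusOfInputs` — T. Bałaban, J. Imbrie, A. Jaffe, *Effective action and cluster properties of the
abelian Higgs model*, Commun. Math. Phys. **114** (1988) 257–315 [BalabanImbrieJaffe1988], Sect. 2 p. 263 [PDF 7], the sentence after (2.33):
*"Bounds analogous to (2.30), (2.31) hold for covariant derivatives and Hölder derivatives of G_{k,loc}(u) of order less than two"* — **THE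
COVARIANT-DERIVATIVE ANALOGUE OF (2.31) WITH `Ω = T_η`, FOR THE PRINTED LOCALIZATION DATA OF RECORD, AT AN ARBITRARY `U(1)` FIELD `u`, FROM THE
FOUR [6]-INPUTS AS HYPOTHESES** (the (1.11)–(1.12) covariant-derivative and value closeness members for the cubes `□_α ⊂ T_η`, the (1.10)
covariant-derivative and value members for `G_k(T_η,u)`, in the binder shapes of the small-field providers) — the background-independent CORE of
gen 27's `deriv231_flat_cwt` / r18 gen 23's `deriv231_wholeTorus_flat_cwt` (flat `u`) and r18 gen 24's `deriv231_regular_torus_cwt` ((2.23)-regular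
`u`), written ONCE so that the member at plaquette-small non-flat `u` is a fifty-line instantiation as soon as its one missing input (the
(1.11)–(1.12) covariant-derivative closeness at small `u`, p30 gen 28's TAKING `BIJ88NeumannPropagatorSmallFieldCloseDeriv` of 2026-08-23T06:08Z)
lands next to the three that exist (p30's `close112_smallField_of_inputs`, `decay110_smallField_deriv`, `decay110_smallField_input`).

statement-level skeleton of published theorems with citation tags; proofs where landed; nothing here is a claim about the Yang–Mills mass gap

PDF held: `paper:balaban1988-cmp114-bij-abelian-higgs-effective-action` (journal page = PDF page + 256); p. 263 [PDF 7] re-read this session (text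
layer `lit read … --pages 7` and the page image `run/shared/lean/pub/lit-balaban/lit-balaban-p31/renders/original-p007-x2.png`).

CITATION HEADER (lean-in-tree rule).  Part of the lit-balaban TYPED SKELETON (HOME `run/shared/lean/pub/lit-balaban/`), PHASE-2 proof seat
p29 gen 30 (unit `lit-balaban-p29-g30`; TAKING line HOME/STATUS.md 2026-08-23 — own lineage: gen 27's `BIJ88LocDeriv231FlatTorus` (the bond
identity `covD_gLocT_sub_apply` and the four-term mechanism), gen 29's HANDOFF item (V) *"Hölder analogues of (2.31) at small u once the small-u
closeness inputs land"*; free-target protocol G.5-34(d)).  Rows **C2.Claim@263** / **C2.Eq2.31** (owner r18; heads = p08's abstract hence-step /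
p02's, unchanged — this is a LOCATED, HYPOTHESIS-FORM member).  Kind: theorems only (no definition, no `Prop`-valued fact; gen 26/27's, r18's,
p13's, p31's declarations used BY NAME).

THE PRINTED TEXT (p. 263, verbatim, print order).  *"|(G_{k,loc}(u)f − G_k(Ω,u)f)(x)| ≦ e^{−cr(e_k)}e^{−c dist(suppt f,x)}‖f‖_∞, (2.31) for
dist(x, Ω^c) ≧ O(r(e_k)). … We assume that u is smooth in the □_α's entering the sum in (2.27); for (2.31) we assume smoothness throughout the
subset Ω ⊂ T_η. … Bounds analogous to (2.30), (2.31) hold for covariant derivatives and Hölder derivatives of G_{k,loc}(u) of order less than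
two."*  [6] = [Balaban1983RegularityDecay] Theorem p. 573: (1.10) *"|(D^η_{A,μ}G_k(Ω,A)f)(x)|, |(G_k(Ω,A)f)(x)| ≤ c₀exp(−δ₀dist(x, supp f))‖f‖_∞"*,
(1.11)–(1.12) *"δG_k(Ω,Ω₀,A) = G_k(Ω,A) − G_k(Ω₀,A) … the inequalities (1.5) and (1.6) … with the additional factor exp(−δ₀dist(x, Ω^c))
exp(−δ₀dist(supp f, Ω^c))"*.

THE MECHANISM (gen 27's, unchanged; declared).  By gen 27's bond identity `covD_gLocT_sub_apply` (row hypothesis (i) of the data at both bond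
ends), `D_u(G_{k,loc}f)(b) − D_u(G_Tf)(b) = Σ_α[D_u(G_α g′_α)(b) − D_u(G_T g′_α)(b)] + ε⁻¹Σ_α[(G_α δg_α)(x) − (G_T δg_α)(x)] + D_u(G_T q′)(b) +
ε⁻¹(G_T δq)(x)` with the row sources `g′_α = ζ″(x′,·)λ_α(x′,·)f`, the bond-difference sources `δg_α`, the tails `q′ = (ζ″(x′,·) − 1)f`,
`δq = (ζ″(x′,·) − ζ″(x,·))f` (`x′ = x + e_μ`).  TERM 1 ← (H1) the (1.11)–(1.12) covariant-derivative closeness for the `≤ m` cubes active at `x′`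
(each contains both bond ends and EVERYTHING of the torus within `R` of the active sources — r18's `rowHyp_ii_torus` at chart depth `≥ R₀ + R`);
TERM 2 ← (H2) the value closeness on the `≤ 2m` difference sources of size `≤ Λ(d)((R₀−R₁)⁻¹ + s⁻¹)‖f‖_∞` (Lipschitz cut-off, smooth weights:
gen 27's `norm_rowSource_sub_le`), `ε⁻¹(L^kε)² = (L^kε)L^k`; TERMS 3–4 ← (H3)/(H4) the (1.10) members of `G_k(T_η,u)` on the tails, supported at
`|x′ − y|_T > R₁` (`ζ″ = 1` inside `R₁`).  All four inputs are HYPOTHESES here, at ONE pair of constants `(c₀, δ₀)` and one input depth `ρ`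
(the rows at which (H1)/(H2) are asked: `dist_∞(x, T∖□) ≥ ρ`; the conclusion needs `R > ρ + 1`).

WHAT IS PROVED (theorems only; 0 `sorry`; standard axioms).
* **`deriv231_wholeTorus_of_inputs`** — for every `d` and `c₀ ≥ 0` THERE IS `C > 0` (depending on `d, c₀` and p13's universal cut-off Lipschitz
  modulus only) such that for every volume (`P.d = d+1`), every `a`, every `1 ≤ k ≤ K_P`, every `U(1)` field `u`, every rate `δ₀ > 0` and input
  depth `ρ ≥ 0`, IF (H1) for every fitting no-wrap cube `□`, every bond `⟨x, x+e_μ⟩` with both ends in `□` and `dist_∞(x, T∖□) ≥ ρ`, every `g`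
  supported in `□` (`‖g‖_∞ ≤ F`, `dist(x, supp g) ≥ D ≥ 0`, `dist(x, T∖□) ≥ D_b ≥ 0`, `dist(supp g, T∖□) ≥ D_f ≥ 0`):
  `‖D_u(G_k(□,u)g)(x,μ) − D_u(G_k(T_η,u)g)(x,μ)‖ ≤ (L^kε)·c₀e^{−δ₀D/L^k}e^{−δ₀(D_b+D_f)/L^k}F`; (H2) the same rows and sources, values, `(L^kε)²`;
  (H3) `‖D_u(G_k(T_η,u)g)(x,μ)‖ ≤ (L^kε)c₀e^{−δ₀D/L^k}F` and (H4) `‖(G_k(T_η,u)g)(x)‖ ≤ (L^kε)²c₀e^{−δ₀D/L^k}F` for every row and every `g`; THEN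
  for the printed data (no-wrap box `Ω₀ = c·L^k + Π_i[0,L^kM₀_i)` shorter than the torus with torus gap `≥ R`, spacing `s ≥ 1`, half-width
  `W ≥ 2s/3 + R₀/2 + R`, radii `R > ρ + 1`, `0 ≤ R₁ < R₀`, the cut-off of record `cutoff R₁ R₀ |·|_T`), every bond `⟨x, x+e_μ⟩` with both ends in
  `Ω₀` at chart depth `≥ R₀ + R` and every `f` (`‖f‖_∞ ≤ F`) supported at sup-torus distance `≥ D ≥ 0` from `x`:
  `‖D_u(G_{k,loc}(u)f)(x,μ) − D_u(G_k(T_η,u)f)(x,μ)‖ ≤ (L^kε)·C·[m(1 + L^k((R₀−R₁)⁻¹ + s⁻¹))e^{−δ₀(2R−1)/L^k} + (1 + L^k(R₀−R₁)⁻¹)e^{−(δ₀/2)(R₁−1)/L^k}]·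
  e^{−(δ₀/2)D/L^k}·F`, `m = (⌊(L^k − 1 + R₀)/s⌋ + 3)^{d+1}` — at the printed radii the bracket is print's `e^{−cr(e_k)}`.
HONEST SCOPE / DIVERGENCE.  (i) HYPOTHESIS FORM: nothing is asserted about which fields `u` admit (H1)–(H4); of record they hold at flat `u`
(p31/r01/r18), at (2.23)-regular `u` with big-block cubes (r01; r18's file has its own cube family), and — (H2)–(H4) — at plaquette-small `u`
(p30 gens 25–27, with p27's cube members); (H1) at small `u` is p30 gen 28's announced file.  (ii) `Ω = T_η` only (the comparison region of r18's
members); the reference box `Ω₀` only carries the data.  (iii) The cut-off is p13's Lipschitz `cutoff R₁ R₀ |·|_T` of record (as gen 27 / r18);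
r18's smooth `zetaPi` is not treated here.  (iv) DEEP BONDS ONLY (chart depth `≥ R₀ + R`, print's *"dist(x, Ω^c) ≧ O(r(e_k))"* located as an explicit
margin).  (v) One pair `(c₀, δ₀)` for the four inputs (consumers align their providers' constants by monotonicity first, as p31's `input110_mono`).
(vi) Constants: `C = max(c₀, 2c₀Λ₀ + 1)`, `Λ₀ = max(K_σ, 3π(d+1)/2)`; not optimized.  `set_option maxHeartbeats 400000` on the theorem (elaboration
budget of the long statement only).  Imports: r18 gen 23 `BIJ88Close231WholeTorusFlatCwt` (→ gen 26/27, p13, p31).  Literature + Mathlib only.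
Unit `lit-balaban-p29` (literature-prover-lit-balaban-p29-g30-0), 2026-08-23.  NOT summit progress.
-/

open scoped BigOperators Matrix ComplexConjugate
open Finset Matrix

namespace Literature.MathematicalPhysics.QuantumFieldTheory.BalabanImbrieJaffe1984to88.BIJ88LocDeriv231TorusOfInputs

open Literature.MathematicalPhysics.QuantumFieldTheory.Balaban1983to89
open BIJ88Sect3Statements (U1 toC cfg covD)
open BIJ85BlockAveragesTorus BIJ85BlockAveragesTorusK
open BIJ88NeumannPropagator227Torus (gBox)
open BIJ88DeltaLoc234Torus (gLocT)
open BIJ88NeumannPropagatorFlatDecayCube (cubeT boxCoord)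
open BIJ88Cutoffs21 (cutoff cutoff_nonneg cutoff_le_one)
open BIJ88LocWeights227Torus
open BIJ88Close231WholeTorusFlatCwt (rowHyp_ii_torus)
open BIJ88NeumannPropagatorFlatClose231 (norm_rowSource_le rowSource_ne_zero abs_lam_le_one)
open BIJ88LocDeriv230FlatTorus (exists_abs_cutoff_sub_le T_shift_le_one abs_T_shift_sub_le norm_rowSource_sub_le)
open BIJ88LocDeriv231FlatTorus (covD_gLocT_sub_apply norm_tail_le norm_tailDiff_le T_gt_of_tail_ne_zero T_gt_of_tailDiff_ne_zero)

noncomputable section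

variable {d : ℕ} {P : Params}

/-- kernel: a deeper chart margin implies a shallower one (r18's private `depth_mono`, re-proved). [folklore] -/
private theorem depth_mono (hPd : P.d = d + 1) {n : ℕ} {c M0 : Fin (d + 1) → ℕ} {D D' : ℝ} (hDD : D ≤ D') {x : Balaban1983to89.Site P 0}
    (hdeep : ∀ i, D' ≤ (boxCoord hPd n c x i : ℝ) ∧ (boxCoord hPd n c x i : ℝ) + D' ≤ (n * M0 i : ℕ) - 1) :
    ∀ i, D ≤ (boxCoord hPd n c x i : ℝ) ∧ (boxCoord hPd n c x i : ℝ) + D ≤ (n * M0 i : ℕ) - 1 :=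
  fun i => ⟨hDD.trans (hdeep i).1, by linarith [(hdeep i).2]⟩

/-- kernel: `e^{−δ'E} ≤ e^{−δE}` for `δ ≤ δ'`, `E ≥ 0`. [folklore] -/
private theorem exp_le_exp_of_rate {δ δ' E : ℝ} (hδ : δ ≤ δ') (hE : 0 ≤ E) : Real.exp (-(δ' * E)) ≤ Real.exp (-(δ * E)) :=
  Real.exp_le_exp.2 (neg_le_neg (mul_le_mul_of_nonneg_right hδ hE))

set_option maxHeartbeats 400000 in
/-- **THE COVARIANT-DERIVATIVE ANALOGUE OF (2.31) WITH `Ω = T_η` FOR THE PRINTED LOCALIZATION DATA, AT AN ARBITRARY `U(1)` FIELD, FROM THE FOUR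
[6]-INPUTS AS HYPOTHESES** (p. 263: *"Bounds analogous to (2.30), (2.31) hold for covariant derivatives and Hölder derivatives of G_{k,loc}(u)
of order less than two"*, the (2.31)-analogue for the covariant derivative, region `Ω = T_η`).  For every `d` and `c₀ ≥ 0` THERE IS `C > 0`
such that for every volume (`P.d = d+1`), every `a`, `1 ≤ k ≤ K_P`, every field `u`, every `δ₀ > 0`, `ρ ≥ 0`, GIVEN (H1) the (1.11)–(1.12)
covariant-derivative closeness `‖D_u(G_k(□,u)g)(x,μ) − D_u(G_k(T_η,u)g)(x,μ)‖ ≤ (L^kε)c₀e^{−δ₀D/L^k}e^{−δ₀(D_b+D_f)/L^k}‖g‖_∞` for every fitting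
no-wrap cube `□`, every bond with both ends in `□` whose source is `ρ`-deep, every `g` supported in `□`; (H2) the same for values with `(L^kε)²`;
(H3)/(H4) the (1.10) covariant-derivative / value members of `G_k(T_η,u)`; THEN for the data of record (torus gap `≥ R > ρ + 1`, `s ≥ 1`,
`W ≥ 2s/3 + R₀/2 + R`, `0 ≤ R₁ < R₀`, cut-off `cutoff R₁ R₀ |·|_T`), every bond `⟨x, x+e_μ⟩` with both ends in `Ω₀` at chart depth `≥ R₀ + R` and
every `f` (`‖f‖_∞ ≤ F`) supported at sup-torus distance `≥ D ≥ 0` from `x`: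
`‖D_u(G_{k,loc}(u)f)(x,μ) − D_u(G_k(T_η,u)f)(x,μ)‖ ≤ (L^kε)·C·[m(1 + L^k((R₀−R₁)⁻¹ + s⁻¹))e^{−δ₀(2R−1)/L^k} + (1 + L^k(R₀−R₁)⁻¹)e^{−(δ₀/2)(R₁−1)/L^k}]·
e^{−(δ₀/2)D/L^k}·F` — gen 27's four-term proof with the inputs abstracted.
[cite: BalabanImbrieJaffe1988, (2.31) p.263] [cite: Balaban1983RegularityDecay, Theorem p.573 (1.10)–(1.12)] -/
theorem deriv231_wholeTorus_of_inputs (d : ℕ) {c₀ : ℝ} (hc₀ : 0 ≤ c₀) :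
    ∃ C : ℝ, 0 < C ∧ ∀ (P : Params) (hPd : P.d = d + 1) (a : ℝ) (k : ℕ), 1 ≤ k → k ≤ P.K →
      ∀ (U : GaugeField P 0 U1) (δ₀ ρ : ℝ), 0 < δ₀ → 0 ≤ ρ →
      -- (H1) the (1.11)–(1.12) covariant-derivative closeness member for the fitting no-wrap cubes `□ ⊂ T_η`
      (∀ (c' M' : Fin (d + 1) → ℕ), (∀ i, 1 ≤ M' i) → (∀ i, c' i * P.L ^ k + P.L ^ k * M' i ≤ P.sitesPerDir 0) →
          (∀ i, P.L ^ k * M' i < P.sitesPerDir 0) →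
        ∀ (x : Balaban1983to89.Site P 0) (μ : Fin P.d), x ∈ (cubeT hPd (P.L ^ k) c' fun i => P.L ^ k * M' i) →
          x.shift μ ∈ (cubeT hPd (P.L ^ k) c' fun i => P.L ^ k * M' i) →
          (∀ w, w ∉ (cubeT hPd (P.L ^ k) c' fun i => P.L ^ k * M' i) → ρ ≤ B5Ineq137Torus.T P 0 x w) →
        ∀ (g : Balaban1983to89.Site P 0 → ℂ) (F D Db Df : ℝ), (∀ y, ‖g y‖ ≤ F) →
          (∀ y, y ∉ (cubeT hPd (P.L ^ k) c' fun i => P.L ^ k * M' i) → g y = 0) →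
          0 ≤ D → (∀ y, g y ≠ 0 → D ≤ B5Ineq137Torus.T P 0 x y) →
          0 ≤ Db → (∀ w, w ∉ (cubeT hPd (P.L ^ k) c' fun i => P.L ^ k * M' i) → Db ≤ B5Ineq137Torus.T P 0 x w) →
          0 ≤ Df → (∀ y, g y ≠ 0 → ∀ w, w ∉ (cubeT hPd (P.L ^ k) c' fun i => P.L ^ k * M' i) → Df ≤ B5Ineq137Torus.T P 0 y w) →
          ‖covD P.eps⁻¹ (cfg U) (gBox (B1RG242Torus.α P a k * (P.L : ℝ) ^ (k * P.d)) P.eps⁻¹ U k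
                  (cubeT hPd (P.L ^ k) c' fun i => P.L ^ k * M' i) *ᵥ g) ⟨x, μ⟩ -
              covD P.eps⁻¹ (cfg U) (gBox (B1RG242Torus.α P a k * (P.L : ℝ) ^ (k * P.d)) P.eps⁻¹ U k univ *ᵥ g) ⟨x, μ⟩‖ ≤
            P.spacing k * (c₀ * Real.exp (-(δ₀ * (((P.L : ℝ) ^ k)⁻¹ * D))) * Real.exp (-(δ₀ * (((P.L : ℝ) ^ k)⁻¹ * (Db + Df)))) * F)) →
      -- (H2) the (1.11)–(1.12) value closeness member for the same cubes and rows
      (∀ (c' M' : Fin (d + 1) → ℕ), (∀ i, 1 ≤ M' i) → (∀ i, c' i * P.L ^ k + P.L ^ k * M' i ≤ P.sitesPerDir 0) →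
          (∀ i, P.L ^ k * M' i < P.sitesPerDir 0) →
        ∀ (x : Balaban1983to89.Site P 0), x ∈ (cubeT hPd (P.L ^ k) c' fun i => P.L ^ k * M' i) →
          (∀ w, w ∉ (cubeT hPd (P.L ^ k) c' fun i => P.L ^ k * M' i) → ρ ≤ B5Ineq137Torus.T P 0 x w) →
        ∀ (g : Balaban1983to89.Site P 0 → ℂ) (F D Db Df : ℝ), (∀ y, ‖g y‖ ≤ F) →
          (∀ y, y ∉ (cubeT hPd (P.L ^ k) c' fun i => P.L ^ k * M' i) → g y = 0) →
          0 ≤ D → (∀ y, g y ≠ 0 → D ≤ B5Ineq137Torus.T P 0 x y) →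
          0 ≤ Db → (∀ w, w ∉ (cubeT hPd (P.L ^ k) c' fun i => P.L ^ k * M' i) → Db ≤ B5Ineq137Torus.T P 0 x w) →
          0 ≤ Df → (∀ y, g y ≠ 0 → ∀ w, w ∉ (cubeT hPd (P.L ^ k) c' fun i => P.L ^ k * M' i) → Df ≤ B5Ineq137Torus.T P 0 y w) →
          ‖(gBox (B1RG242Torus.α P a k * (P.L : ℝ) ^ (k * P.d)) P.eps⁻¹ U k (cubeT hPd (P.L ^ k) c' fun i => P.L ^ k * M' i) *ᵥ g) x -
              (gBox (B1RG242Torus.α P a k * (P.L : ℝ) ^ (k * P.d)) P.eps⁻¹ U k univ *ᵥ g) x‖ ≤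
            P.spacing k ^ 2 * (c₀ * Real.exp (-(δ₀ * (((P.L : ℝ) ^ k)⁻¹ * D))) * Real.exp (-(δ₀ * (((P.L : ℝ) ^ k)⁻¹ * (Db + Df)))) * F)) →
      -- (H3) the (1.10) covariant-derivative member of `G_k(T_η,u)`
      (∀ (x : Balaban1983to89.Site P 0) (μ : Fin P.d) (g : Balaban1983to89.Site P 0 → ℂ) (F D : ℝ), (∀ y, ‖g y‖ ≤ F) → 0 ≤ D →
          (∀ y, g y ≠ 0 → D ≤ B5Ineq137Torus.T P 0 x y) →
          ‖covD P.eps⁻¹ (cfg U) (gBox (B1RG242Torus.α P a k * (P.L : ℝ) ^ (k * P.d)) P.eps⁻¹ U k univ *ᵥ g) ⟨x, μ⟩‖ ≤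
            P.spacing k * (c₀ * Real.exp (-(δ₀ * (((P.L : ℝ) ^ k)⁻¹ * D))) * F)) →
      -- (H4) the (1.10) value member of `G_k(T_η,u)`
      (∀ (x : Balaban1983to89.Site P 0) (g : Balaban1983to89.Site P 0 → ℂ) (F D : ℝ), (∀ y, ‖g y‖ ≤ F) → 0 ≤ D →
          (∀ y, g y ≠ 0 → D ≤ B5Ineq137Torus.T P 0 x y) →
          ‖(gBox (B1RG242Torus.α P a k * (P.L : ℝ) ^ (k * P.d)) P.eps⁻¹ U k univ *ᵥ g) x‖ ≤
            P.spacing k ^ 2 * (c₀ * Real.exp (-(δ₀ * (((P.L : ℝ) ^ k)⁻¹ * D))) * F)) →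
      ∀ (c M0 : Fin (d + 1) → ℕ), (∀ i, 1 ≤ M0 i) →
        (∀ i, c i * P.L ^ k + P.L ^ k * M0 i ≤ P.sitesPerDir 0) → (∀ i, P.L ^ k * M0 i < P.sitesPerDir 0) →
      ∀ (s W : ℕ), 1 ≤ s → ∀ (R R₀ R₁ : ℝ), ρ + 1 < R → 0 ≤ R₁ → R₁ < R₀ → 2 * (s : ℝ) / 3 + R₀ / 2 + R ≤ W →
        (∀ i, ((P.L ^ k * M0 i : ℕ) : ℝ) + R ≤ P.sitesPerDir 0) →
      ∀ (x : Balaban1983to89.Site P 0) (μ : Fin P.d),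
        x ∈ (cubeT hPd (P.L ^ k) c fun i => P.L ^ k * M0 i) →
        (∀ i, R₀ + R ≤ (boxCoord hPd (P.L ^ k) c x i : ℝ) ∧ (boxCoord hPd (P.L ^ k) c x i : ℝ) + (R₀ + R) ≤ (P.L ^ k * M0 i : ℕ) - 1) →
        x.shift μ ∈ (cubeT hPd (P.L ^ k) c fun i => P.L ^ k * M0 i) →
        (∀ i, R₀ + R ≤ (boxCoord hPd (P.L ^ k) c (x.shift μ) i : ℝ) ∧
          (boxCoord hPd (P.L ^ k) c (x.shift μ) i : ℝ) + (R₀ + R) ≤ (P.L ^ k * M0 i : ℕ) - 1) →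
      ∀ (f : Balaban1983to89.Site P 0 → ℂ) (F D : ℝ), (∀ y, ‖f y‖ ≤ F) → 0 ≤ D → (∀ y, f y ≠ 0 → D ≤ B5Ineq137Torus.T P 0 x y) →
        ‖covD P.eps⁻¹ (cfg U)
              (gLocT (B1RG242Torus.α P a k * (P.L : ℝ) ^ (k * P.d)) P.eps⁻¹ U k
                (cubeFam hPd (P.L ^ k) c M0 s W) (lamFam hPd (P.L ^ k) c M0 s) (cutoff R₁ R₀ (B5Ineq137Torus.T P 0)) *ᵥ f) ⟨x, μ⟩ -
            covD P.eps⁻¹ (cfg U) (gBox (B1RG242Torus.α P a k * (P.L : ℝ) ^ (k * P.d)) P.eps⁻¹ U k univ *ᵥ f) ⟨x, μ⟩‖ ≤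
          P.spacing k * (C * ((⌊(((P.L : ℝ) ^ k) - 1 + R₀) / s⌋₊ + 3) ^ (d + 1) * (1 + (P.L : ℝ) ^ k * ((R₀ - R₁)⁻¹ + (s : ℝ)⁻¹)) *
              Real.exp (-(δ₀ * (((P.L : ℝ) ^ k)⁻¹ * (2 * R - 1)))) +
            (1 + (P.L : ℝ) ^ k * (R₀ - R₁)⁻¹) * Real.exp (-(δ₀ / 2 * (((P.L : ℝ) ^ k)⁻¹ * (R₁ - 1))))) *
            Real.exp (-(δ₀ / 2 * (((P.L : ℝ) ^ k)⁻¹ * D))) * F) := by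
  obtain ⟨K, hK0, hK⟩ := exists_abs_cutoff_sub_le
  set Λ₀ : ℝ := max K (3 * Real.pi * (d + 1 : ℕ) / 2) with hΛ₀def
  have hΛ₀0 : 0 ≤ Λ₀ := hK0.trans (le_max_left _ _)
  have hΛ₀K : K ≤ Λ₀ := le_max_left _ _
  set C : ℝ := max c₀ (2 * c₀ * Λ₀ + 1) with hCdef
  have hC1 : c₀ ≤ C := le_max_left _ _
  have hC2 : 2 * c₀ * Λ₀ + 1 ≤ C := le_max_right _ _
  have hC3 : c₀ ≤ C := hC1
  have hC4 : c₀ * Λ₀ + 1 ≤ C := by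
    have : 0 ≤ c₀ * Λ₀ := mul_nonneg hc₀ hΛ₀0
    linarith
  have hC0 : 0 ≤ C := hc₀.trans hC1
  refine ⟨C, lt_of_lt_of_le (by linarith [mul_nonneg hc₀ hΛ₀0]) hC2, ?_⟩
  intro P hPd a k _hk1 hkK U δ₀ ρ hδ₀ hρ H1 H2 H3 H4 c M0 hM0 hfit0 hN0 s W hs R R₀ R₁ hR hR₁ hR10 hW hgap x μ hx hdeep hxe hdeepe f F D hF
    hD hsupp
  have hn : 1 ≤ P.L ^ k := Nat.one_le_pow _ _ P.L_pos
  have hk : 0 + k ≤ P.m + P.K := by omega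
  have hR1 : 1 < R := by linarith
  have hR0 : 0 ≤ R := by linarith
  have hR₀ : 0 ≤ R₀ := hR₁.trans hR10.le
  have hs0 : 0 < s := hs
  have hsr : (0 : ℝ) < s := by exact_mod_cast hs0
  have hgap' : 0 < R₀ - R₁ := sub_pos.2 hR10
  have hLpos : (0 : ℝ) < P.L := P.cast_L_pos
  have hLk : (0 : ℝ) < (P.L : ℝ) ^ k := pow_pos hLpos _
  have hε : 0 < ((P.L : ℝ) ^ k)⁻¹ := inv_pos.mpr hLk
  have hF0 : 0 ≤ F := (norm_nonneg _).trans (hF x)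
  have hsp0 : 0 < P.spacing k := P.spacing_pos k
  have heps : 0 < P.eps := P.eps_pos
  have hζ0 := cutoff_eq_zero_of_le (P := P) hR10
  -- the shallower depth `R₀` (row hypothesis (i), the label multiplicities) at both endpoints
  have hdeep₀ := depth_mono hPd (show R₀ ≤ R₀ + R by linarith) hdeep
  have hdeepe₀ := depth_mono hPd (show R₀ ≤ R₀ + R by linarith) hdeepe
  -- abbreviations
  set Ω₀ : Finset (Balaban1983to89.Site P 0) := cubeT hPd (P.L ^ k) c fun i => P.L ^ k * M0 i with hΩ₀def
  set A : ℝ := B1RG242Torus.α P a k * (P.L : ℝ) ^ (k * P.d) with hAdef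
  set ζ := cutoff R₁ R₀ (B5Ineq137Torus.T P 0) with hζdef
  set x' := x.shift μ with hx'def
  set G₀ := gBox A P.eps⁻¹ U k univ with hG₀def
  set m : ℝ := ((⌊(((P.L : ℝ) ^ k) - 1 + R₀) / s⌋₊ : ℝ) + 3) ^ (d + 1) with hmdef
  have hm0 : 0 ≤ m := by rw [hmdef]; positivity
  set E : ℝ := Real.exp (-(δ₀ / 2 * (((P.L : ℝ) ^ k)⁻¹ * D))) with hEdef
  set E2R : ℝ := Real.exp (-(δ₀ * (((P.L : ℝ) ^ k)⁻¹ * (2 * R - 1)))) with hE2Rdef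
  set ER1 : ℝ := Real.exp (-(δ₀ / 2 * (((P.L : ℝ) ^ k)⁻¹ * (R₁ - 1)))) with hER1def
  have hE0 : 0 < E := Real.exp_pos _
  have hE2R0 : 0 < E2R := Real.exp_pos _
  have hER10 : 0 < ER1 := Real.exp_pos _
  have hεD : 0 ≤ ((P.L : ℝ) ^ k)⁻¹ * D := mul_nonneg hε.le hD
  have hε2R : 0 ≤ ((P.L : ℝ) ^ k)⁻¹ * (2 * R - 1) := mul_nonneg hε.le (by linarith)
  -- exponent bookkeeping: `e^{−δ_iD/L^k} ≤ E`-type facts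
  have hED : ∀ {δ'}, δ₀ ≤ δ' → Real.exp (-(δ' * (((P.L : ℝ) ^ k)⁻¹ * D))) ≤ E := by
    intro δ' hδ'
    refine (exp_le_exp_of_rate hδ' hεD).trans (Real.exp_le_exp.2 ?_)
    have := mul_nonneg hδ₀.le hεD
    linarith
  have hE2 : ∀ {δ'}, δ₀ ≤ δ' → Real.exp (-(δ' * (((P.L : ℝ) ^ k)⁻¹ * (R - 1 + R)))) ≤ E2R := by
    intro δ' hδ'
    rw [show R - 1 + R = 2 * R - 1 by ring]
    exact exp_le_exp_of_rate hδ' hε2R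
  set D' : ℝ := max D (R₁ - 1) with hD'def
  have hD'D : D ≤ D' := le_max_left _ _
  have hD'R : R₁ - 1 ≤ D' := le_max_right _ _
  have hD'0 : 0 ≤ D' := hD.trans hD'D
  have hED' : ∀ {δ'}, δ₀ ≤ δ' → Real.exp (-(δ' * (((P.L : ℝ) ^ k)⁻¹ * D'))) ≤ E * ER1 := by
    intro δ' hδ'
    rw [hEdef, hER1def, ← Real.exp_add]
    refine Real.exp_le_exp.2 ?_
    have hD'0' : 0 ≤ ((P.L : ℝ) ^ k)⁻¹ * D' := mul_nonneg hε.le hD'0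
    have h1 : δ₀ * (((P.L : ℝ) ^ k)⁻¹ * D') ≤ δ' * (((P.L : ℝ) ^ k)⁻¹ * D') := mul_le_mul_of_nonneg_right hδ' hD'0'
    have h2 : δ₀ / 2 * (((P.L : ℝ) ^ k)⁻¹ * D) + δ₀ / 2 * (((P.L : ℝ) ^ k)⁻¹ * (R₁ - 1)) ≤ δ₀ * (((P.L : ℝ) ^ k)⁻¹ * D') := by
      have : D + (R₁ - 1) ≤ 2 * D' := by linarith
      calc δ₀ / 2 * (((P.L : ℝ) ^ k)⁻¹ * D) + δ₀ / 2 * (((P.L : ℝ) ^ k)⁻¹ * (R₁ - 1))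
          = δ₀ / 2 * (((P.L : ℝ) ^ k)⁻¹ * (D + (R₁ - 1))) := by ring
        _ ≤ δ₀ / 2 * (((P.L : ℝ) ^ k)⁻¹ * (2 * D')) :=
            mul_le_mul_of_nonneg_left (mul_le_mul_of_nonneg_left this hε.le) (by positivity)
        _ = δ₀ * (((P.L : ℝ) ^ k)⁻¹ * D') := by ring
    linarith
  -- the sources
  set g' : ↥(labels (P.L ^ k) M0 s) → Balaban1983to89.Site P 0 → ℂ :=
    fun α y => (ζ x' y : ℂ) * (lamFam hPd (P.L ^ k) c M0 s α x' y : ℂ) * f y with hg'def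
  set dg : ↥(labels (P.L ^ k) M0 s) → Balaban1983to89.Site P 0 → ℂ :=
    fun α y => ((ζ x' y : ℂ) * (lamFam hPd (P.L ^ k) c M0 s α x' y : ℂ) - (ζ x y : ℂ) * (lamFam hPd (P.L ^ k) c M0 s α x y : ℂ)) * f y
    with hdgdef
  set q' : Balaban1983to89.Site P 0 → ℂ := fun y => ((ζ x' y : ℂ) - 1) * f y with hq'def
  set dq : Balaban1983to89.Site P 0 → ℂ := fun y => ((ζ x' y : ℂ) - (ζ x y : ℂ)) * f y with hdqdef
  -- the four-term identity (row hypothesis (i) at both endpoints)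
  have hid : covD P.eps⁻¹ (cfg U) (gLocT A P.eps⁻¹ U k (cubeFam hPd (P.L ^ k) c M0 s W) (lamFam hPd (P.L ^ k) c M0 s) ζ *ᵥ f) ⟨x, μ⟩ -
      covD P.eps⁻¹ (cfg U) (G₀ *ᵥ f) ⟨x, μ⟩ =
      ∑ α, (covD P.eps⁻¹ (cfg U) (gBox A P.eps⁻¹ U k (cubeFam hPd (P.L ^ k) c M0 s W α) *ᵥ g' α) ⟨x, μ⟩ -
              covD P.eps⁻¹ (cfg U) (G₀ *ᵥ g' α) ⟨x, μ⟩) +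
      ∑ α, ((P.eps⁻¹ : ℝ) : ℂ) * ((gBox A P.eps⁻¹ U k (cubeFam hPd (P.L ^ k) c M0 s W α) *ᵥ dg α) x - (G₀ *ᵥ dg α) x) +
      covD P.eps⁻¹ (cfg U) (G₀ *ᵥ q') ⟨x, μ⟩ + ((P.eps⁻¹ : ℝ) : ℂ) * (G₀ *ᵥ dq) x :=
    covD_gLocT_sub_apply P.eps⁻¹ (cfg U) A P.eps⁻¹ U k (cubeFam hPd (P.L ^ k) c M0 s W) (lamFam hPd (P.L ^ k) c M0 s) ζ G₀ f ⟨x, μ⟩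
      (rowHyp_i hPd hfit0 hζ0 hxe hdeepe₀) (rowHyp_i hPd hfit0 hζ0 hx hdeep₀)
  rw [hid]
  -- the active-label sets of the two endpoints
  set Sx : Finset ↥(labels (P.L ^ k) M0 s) := (activeLabels hPd (P.L ^ k) c s R₀ (blkIter k x)).subtype fun α => α ∈ labels (P.L ^ k) M0 s
    with hSxdef
  set Sx' : Finset ↥(labels (P.L ^ k) M0 s) := (activeLabels hPd (P.L ^ k) c s R₀ (blkIter k x')).subtype fun α => α ∈ labels (P.L ^ k) M0 s
    with hSx'def
  have hcardx : (Sx.card : ℝ) ≤ m := by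
    have h1 := card_subtype_activeLabels_le (hPd := hPd) (c := c) (M0 := M0) hn hs0 hR₀ (blkIter k x)
    have e : (((P.L ^ k : ℕ) : ℕ) : ℝ) = (P.L : ℝ) ^ k := by push_cast; rfl
    rw [hSxdef, hmdef]; rw [e] at h1; exact h1
  have hcardx' : (Sx'.card : ℝ) ≤ m := by
    have h1 := card_subtype_activeLabels_le (hPd := hPd) (c := c) (M0 := M0) hn hs0 hR₀ (blkIter k x')
    have e : (((P.L ^ k : ℕ) : ℕ) : ℝ) = (P.L : ℝ) ^ k := by push_cast; rfl
    rw [hSx'def, hmdef]; rw [e] at h1; exact h1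
  have hSx : ∀ (α : ↥(labels (P.L ^ k) M0 s)) (y : Balaban1983to89.Site P 0),
      ζ x y * lamFam hPd (P.L ^ k) c M0 s α x y ≠ 0 → α ∈ Sx := by
    intro α y hne
    rw [hSxdef, Finset.mem_subtype]
    exact mem_activeLabels_of_ne_zero_of_deep hk hs0 hfit0 hζ0 (mem_blockK.2 rfl) hdeep₀ hne
  have hSx' : ∀ (α : ↥(labels (P.L ^ k) M0 s)) (y : Balaban1983to89.Site P 0),
      ζ x' y * lamFam hPd (P.L ^ k) c M0 s α x' y ≠ 0 → α ∈ Sx' := by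
    intro α y hne
    rw [hSx'def, Finset.mem_subtype]
    exact mem_activeLabels_of_ne_zero_of_deep hk hs0 hfit0 hζ0 (mem_blockK.2 rfl) hdeepe₀ hne
  have hcardU : ((Sx ∪ Sx').card : ℝ) ≤ 2 * m := by
    have h1 : ((Sx ∪ Sx').card : ℝ) ≤ (Sx.card : ℝ) + (Sx'.card : ℝ) := by exact_mod_cast Finset.card_union_le _ _
    linarith
  -- geometry of an active cube READ AGAINST THE WHOLE TORUS: both endpoints and the active sources inside, `T_η ∖ □_α` far
  have hstep : B5Ineq137Torus.T P 0 x' x ≤ 1 := by rw [B5Ineq137Torus.T_symm]; exact T_shift_le_one x μ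
  have hgeo' : ∀ (α : ↥(labels (P.L ^ k) M0 s)) (y₀ : Balaban1983to89.Site P 0), ζ x' y₀ * lamFam hPd (P.L ^ k) c M0 s α x' y₀ ≠ 0 →
      x ∈ cubeFam hPd (P.L ^ k) c M0 s W α ∧ x' ∈ cubeFam hPd (P.L ^ k) c M0 s W α ∧
      (∀ w, w ∉ cubeFam hPd (P.L ^ k) c M0 s W α → R - 1 ≤ B5Ineq137Torus.T P 0 x w) := by
    intro α y₀ hy₀
    obtain ⟨hx'α, -, hfar⟩ := rowHyp_ii_torus hPd hn hs0 hfit0 hR0 hR₀ hgap hW hζ0 hxe hdeepe α y₀ hy₀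
    have hxα : x ∈ cubeFam hPd (P.L ^ k) c M0 s W α := by
      by_contra hnot
      have h1 := (hfar x hnot).1
      linarith
    refine ⟨hxα, hx'α, fun w hnot => ?_⟩
    have h1 := (hfar w hnot).1
    have h2 := abs_le.1 (abs_T_shift_sub_le x w μ)
    linarith
  have hgeo : ∀ (α : ↥(labels (P.L ^ k) M0 s)) (y₀ : Balaban1983to89.Site P 0), ζ x y₀ * lamFam hPd (P.L ^ k) c M0 s α x y₀ ≠ 0 →
      x ∈ cubeFam hPd (P.L ^ k) c M0 s W α ∧
      (∀ w, w ∉ cubeFam hPd (P.L ^ k) c M0 s W α → R - 1 ≤ B5Ineq137Torus.T P 0 x w) := by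
    intro α y₀ hy₀
    obtain ⟨hxα, -, hfar⟩ := rowHyp_ii_torus hPd hn hs0 hfit0 hR0 hR₀ hgap hW hζ0 hx hdeep α y₀ hy₀
    exact ⟨hxα, fun w hnot => by linarith [(hfar w hnot).1]⟩
  have hζabs : ∀ z y, |ζ z y| ≤ 1 := fun z y => by
    rw [hζdef, abs_of_nonneg (cutoff_nonneg _ _ _ _ _)]; exact cutoff_le_one _ _ _ _ _
  -- TERM 1: the (1.11)–(1.12) covariant-derivative closeness input (H1) for the cubes active at `x'`
  set B₁ : ℝ := P.spacing k * (c₀ * Real.exp (-(δ₀ * (((P.L : ℝ) ^ k)⁻¹ * D))) *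
    Real.exp (-(δ₀ * (((P.L : ℝ) ^ k)⁻¹ * (R - 1 + R)))) * F) with hB₁def
  have hB₁0 : 0 ≤ B₁ := by positivity
  have hterm1 : ∀ α, ‖covD P.eps⁻¹ (cfg U) (gBox A P.eps⁻¹ U k (cubeFam hPd (P.L ^ k) c M0 s W α) *ᵥ g' α) ⟨x, μ⟩ -
      covD P.eps⁻¹ (cfg U) (G₀ *ᵥ g' α) ⟨x, μ⟩‖ ≤ B₁ := by
    intro α
    by_cases hex : ∃ y, ζ x' y * lamFam hPd (P.L ^ k) c M0 s α x' y ≠ 0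
    · obtain ⟨y₀, hy₀⟩ := hex
      obtain ⟨hxα, hx'α, hfarx⟩ := hgeo' α y₀ hy₀
      obtain ⟨c', M', hM', hfit', hN', hcα⟩ := cubeFam_fits (hPd := hPd) (n := P.L ^ k) (c := c) (s := s) (W := W) hM0 hfit0 hN0 α
      have hsuppα : ∀ y, y ∉ cubeFam hPd (P.L ^ k) c M0 s W α → g' α y = 0 := by
        intro y hy
        by_contra hne
        exact hy (rowHyp_ii_torus hPd hn hs0 hfit0 hR0 hR₀ hgap hW hζ0 hxe hdeepe α y (rowSource_ne_zero hne).1).2.1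
      have hDf : ∀ y, g' α y ≠ 0 → ∀ w, w ∉ cubeFam hPd (P.L ^ k) c M0 s W α → R ≤ B5Ineq137Torus.T P 0 y w :=
        fun y hy w hw' => ((rowHyp_ii_torus hPd hn hs0 hfit0 hR0 hR₀ hgap hW hζ0 hxe hdeepe α y (rowSource_ne_zero hy).1).2.2 w hw').2
      rw [hcα] at hxα hx'α hfarx hsuppα hDf ⊢
      have hρx : ∀ w, w ∉ (cubeT hPd (P.L ^ k) c' fun i => P.L ^ k * M' i) → ρ ≤ B5Ineq137Torus.T P 0 x w :=
        fun w hw => by linarith [hfarx w hw]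
      exact H1 c' M' hM' hfit' hN' x μ hxα hx'α hρx (g' α) F D (R - 1) R
        (fun y => norm_rowSource_le (hζabs x' y) (abs_lam_le_one (sum_abs_lamT_le_one hfit0) α x' y) hF y)
        hsuppα hD (fun y hy => hsupp y (rowSource_ne_zero hy).2) (by linarith) hfarx hR0 hDf
    · push Not at hex
      have h0 : g' α = 0 := by
        funext y; rw [hg'def]; dsimp only; rw [← Complex.ofReal_mul, hex y, Complex.ofReal_zero, zero_mul]; rfl
      rw [h0, mulVec_zero, mulVec_zero]
      simp only [covD, Pi.zero_apply, mul_zero, sub_zero, norm_zero]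
      exact hB₁0
  have hzero1 : ∀ α, α ∉ Sx' → covD P.eps⁻¹ (cfg U) (gBox A P.eps⁻¹ U k (cubeFam hPd (P.L ^ k) c M0 s W α) *ᵥ g' α) ⟨x, μ⟩ -
      covD P.eps⁻¹ (cfg U) (G₀ *ᵥ g' α) ⟨x, μ⟩ = 0 := by
    intro α hα
    have h0 : g' α = 0 := by
      funext y
      by_contra hne
      exact hα (hSx' α y (rowSource_ne_zero hne).1)
    rw [h0, mulVec_zero, mulVec_zero]
    simp only [covD, Pi.zero_apply, mul_zero, sub_zero]
  have hsum1 : ‖∑ α, (covD P.eps⁻¹ (cfg U) (gBox A P.eps⁻¹ U k (cubeFam hPd (P.L ^ k) c M0 s W α) *ᵥ g' α) ⟨x, μ⟩ -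
      covD P.eps⁻¹ (cfg U) (G₀ *ᵥ g' α) ⟨x, μ⟩)‖ ≤ m * B₁ := by
    rw [← Finset.sum_subset (Finset.subset_univ Sx') (fun α _ hα => hzero1 α hα)]
    calc ‖∑ α ∈ Sx', (covD P.eps⁻¹ (cfg U) (gBox A P.eps⁻¹ U k (cubeFam hPd (P.L ^ k) c M0 s W α) *ᵥ g' α) ⟨x, μ⟩ -
            covD P.eps⁻¹ (cfg U) (G₀ *ᵥ g' α) ⟨x, μ⟩)‖
        ≤ ∑ α ∈ Sx', ‖covD P.eps⁻¹ (cfg U) (gBox A P.eps⁻¹ U k (cubeFam hPd (P.L ^ k) c M0 s W α) *ᵥ g' α) ⟨x, μ⟩ -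
            covD P.eps⁻¹ (cfg U) (G₀ *ᵥ g' α) ⟨x, μ⟩‖ := norm_sum_le _ _
      _ ≤ ∑ α ∈ Sx', B₁ := Finset.sum_le_sum fun α _ => hterm1 α
      _ = Sx'.card * B₁ := by rw [Finset.sum_const, nsmul_eq_mul]
      _ ≤ m * B₁ := mul_le_mul_of_nonneg_right hcardx' hB₁0
  -- TERM 2: the (1.11)–(1.12) value closeness input (H2) on the difference sources, cubes active at `x` or `x'`
  set Λ : ℝ := K / (R₀ - R₁) + 3 * Real.pi * (d + 1 : ℕ) / (2 * s) with hΛdef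
  have hΛ0 : 0 ≤ Λ := by rw [hΛdef]; positivity
  set B₂ : ℝ := P.spacing k ^ 2 * (c₀ * Real.exp (-(δ₀ * (((P.L : ℝ) ^ k)⁻¹ * D))) *
    Real.exp (-(δ₀ * (((P.L : ℝ) ^ k)⁻¹ * (R - 1 + R)))) * (Λ * F)) with hB₂def
  have hB₂0 : 0 ≤ B₂ := by positivity
  have hterm2 : ∀ α, ‖(gBox A P.eps⁻¹ U k (cubeFam hPd (P.L ^ k) c M0 s W α) *ᵥ dg α) x - (G₀ *ᵥ dg α) x‖ ≤ B₂ := by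
    intro α
    by_cases hex : ∃ y, dg α y ≠ 0
    · obtain ⟨y₀, hy₀⟩ := hex
      -- an active pair at one endpoint: `x` is in the cube and `T_η ∖ □_α` is `≥ R − 1` away from `x`
      have hact : ∀ y, dg α y ≠ 0 → ζ x' y * lamFam hPd (P.L ^ k) c M0 s α x' y ≠ 0 ∨ ζ x y * lamFam hPd (P.L ^ k) c M0 s α x y ≠ 0 := by
        intro y hy
        by_contra hno
        rw [not_or, not_not, not_not] at hno
        apply hy
        rw [hdgdef]; dsimp only
        rw [← Complex.ofReal_mul, ← Complex.ofReal_mul, hno.1, hno.2]; simp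
      have hxfar : x ∈ cubeFam hPd (P.L ^ k) c M0 s W α ∧
          ∀ w, w ∉ cubeFam hPd (P.L ^ k) c M0 s W α → R - 1 ≤ B5Ineq137Torus.T P 0 x w := by
        rcases hact y₀ hy₀ with h1 | h1
        · exact ⟨(hgeo' α y₀ h1).1, (hgeo' α y₀ h1).2.2⟩
        · exact hgeo α y₀ h1
      obtain ⟨hxα, hfarx⟩ := hxfar
      obtain ⟨c', M', hM', hfit', hN', hcα⟩ := cubeFam_fits (hPd := hPd) (n := P.L ^ k) (c := c) (s := s) (W := W) hM0 hfit0 hN0 α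
      have hsuppα : ∀ y, y ∉ cubeFam hPd (P.L ^ k) c M0 s W α → dg α y = 0 := by
        intro y hy
        by_contra hne
        rcases hact y hne with h1 | h1
        · exact hy (rowHyp_ii_torus hPd hn hs0 hfit0 hR0 hR₀ hgap hW hζ0 hxe hdeepe α y h1).2.1
        · exact hy (rowHyp_ii_torus hPd hn hs0 hfit0 hR0 hR₀ hgap hW hζ0 hx hdeep α y h1).2.1
      have hDf : ∀ y, dg α y ≠ 0 → ∀ w, w ∉ cubeFam hPd (P.L ^ k) c M0 s W α → R ≤ B5Ineq137Torus.T P 0 y w := by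
        intro y hy w hw'
        rcases hact y hy with h1 | h1
        · exact ((rowHyp_ii_torus hPd hn hs0 hfit0 hR0 hR₀ hgap hW hζ0 hxe hdeepe α y h1).2.2 w hw').2
        · exact ((rowHyp_ii_torus hPd hn hs0 hfit0 hR0 hR₀ hgap hW hζ0 hx hdeep α y h1).2.2 w hw').2
      rw [hcα] at hxα hfarx hsuppα hDf ⊢
      have hρx : ∀ w, w ∉ (cubeT hPd (P.L ^ k) c' fun i => P.L ^ k * M' i) → ρ ≤ B5Ineq137Torus.T P 0 x w :=
        fun w hw => by linarith [hfarx w hw]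
      exact H2 c' M' hM' hfit' hN' x hxα hρx (dg α) (Λ * F) D (R - 1) R
        (fun y => norm_rowSource_sub_le hPd hs0 hfit0 hN0 hK0 hR10 (hK R₁ R₀ hR10 (B5Ineq137Torus.T P 0)) α.1 hx hxe hF y)
        hsuppα hD (fun y hy => hsupp y (right_ne_zero_of_mul hy)) (by linarith) hfarx hR0 hDf
    · push Not at hex
      have h0 : dg α = 0 := funext hex
      rw [h0, mulVec_zero, mulVec_zero, Pi.zero_apply, sub_zero, norm_zero]
      exact hB₂0
  have hzero2 : ∀ α, α ∉ Sx ∪ Sx' → (gBox A P.eps⁻¹ U k (cubeFam hPd (P.L ^ k) c M0 s W α) *ᵥ dg α) x - (G₀ *ᵥ dg α) x = 0 := by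
    intro α hα
    rw [Finset.mem_union, not_or] at hα
    have h0 : dg α = 0 := by
      funext y
      rw [hdgdef]; dsimp only
      have h1 : ζ x' y * lamFam hPd (P.L ^ k) c M0 s α x' y = 0 := by
        by_contra hne; exact hα.2 (hSx' α y hne)
      have h2 : ζ x y * lamFam hPd (P.L ^ k) c M0 s α x y = 0 := by
        by_contra hne; exact hα.1 (hSx α y hne)
      rw [← Complex.ofReal_mul, ← Complex.ofReal_mul, h1, h2]; simp
    rw [h0, mulVec_zero, mulVec_zero, Pi.zero_apply, sub_zero]
  have hsum2 : ‖∑ α, ((P.eps⁻¹ : ℝ) : ℂ) * ((gBox A P.eps⁻¹ U k (cubeFam hPd (P.L ^ k) c M0 s W α) *ᵥ dg α) x - (G₀ *ᵥ dg α) x)‖ ≤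
      P.eps⁻¹ * (2 * m * B₂) := by
    rw [← Finset.mul_sum, norm_mul, Complex.norm_real, Real.norm_eq_abs, abs_of_pos (inv_pos.mpr heps)]
    refine mul_le_mul_of_nonneg_left ?_ (inv_pos.mpr heps).le
    rw [← Finset.sum_subset (Finset.subset_univ (Sx ∪ Sx')) (fun α _ hα => hzero2 α hα)]
    calc ‖∑ α ∈ Sx ∪ Sx', ((gBox A P.eps⁻¹ U k (cubeFam hPd (P.L ^ k) c M0 s W α) *ᵥ dg α) x - (G₀ *ᵥ dg α) x)‖
        ≤ ∑ α ∈ Sx ∪ Sx', ‖(gBox A P.eps⁻¹ U k (cubeFam hPd (P.L ^ k) c M0 s W α) *ᵥ dg α) x - (G₀ *ᵥ dg α) x‖ := norm_sum_le _ _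
      _ ≤ ∑ α ∈ Sx ∪ Sx', B₂ := Finset.sum_le_sum fun α _ => hterm2 α
      _ = (Sx ∪ Sx').card * B₂ := by rw [Finset.sum_const, nsmul_eq_mul]
      _ ≤ 2 * m * B₂ := mul_le_mul_of_nonneg_right hcardU hB₂0
  -- TERM 3: the (1.10) covariant-derivative input (H3) for `G_k(T_η,u)` on the tail `q'`
  set B₃ : ℝ := P.spacing k * (c₀ * Real.exp (-(δ₀ * (((P.L : ℝ) ^ k)⁻¹ * D'))) * F) with hB₃def
  have hterm3 : ‖covD P.eps⁻¹ (cfg U) (G₀ *ᵥ q') ⟨x, μ⟩‖ ≤ B₃ := by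
    have hsq : ∀ y, q' y ≠ 0 → D' ≤ B5Ineq137Torus.T P 0 x y := fun y hy => by
      obtain ⟨hf, hT⟩ := T_gt_of_tail_ne_zero hR10 x μ hy
      exact max_le (hsupp y hf) hT.le
    exact H3 x μ q' F D' (fun y => norm_tail_le x' hF y) hD'0 hsq
  -- TERM 4: the (1.10) value input (H4) for `G_k(T_η,u)` on the tail difference `dq`
  set B₄ : ℝ := P.spacing k ^ 2 * (c₀ * Real.exp (-(δ₀ * (((P.L : ℝ) ^ k)⁻¹ * D'))) * (K / (R₀ - R₁) * F)) with hB₄def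
  have hterm4 : ‖((P.eps⁻¹ : ℝ) : ℂ) * (G₀ *ᵥ dq) x‖ ≤ P.eps⁻¹ * B₄ := by
    rw [norm_mul, Complex.norm_real, Real.norm_eq_abs, abs_of_pos (inv_pos.mpr heps)]
    refine mul_le_mul_of_nonneg_left ?_ (inv_pos.mpr heps).le
    have hsq : ∀ y, dq y ≠ 0 → D' ≤ B5Ineq137Torus.T P 0 x y := fun y hy => by
      obtain ⟨hf, hT⟩ := T_gt_of_tailDiff_ne_zero hR10 x μ hy
      exact max_le (hsupp y hf) hT.le
    exact H4 x dq (K / (R₀ - R₁) * F) D' (fun y => norm_tailDiff_le hK0 hR10 (hK R₁ R₀ hR10 (B5Ineq137Torus.T P 0)) x μ hF y) hD'0 hsq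
  -- assembling (verbatim from gen 27's `deriv231_flat_cwt` / r18's `deriv231_wholeTorus_flat_cwt`)
  have hscale : P.eps⁻¹ * P.spacing k ^ 2 = P.spacing k * (P.L : ℝ) ^ k := by
    rw [Params.spacing]
    field_simp
  have hΛle : Λ ≤ Λ₀ * ((R₀ - R₁)⁻¹ + (s : ℝ)⁻¹) := by
    rw [hΛdef, mul_add]
    refine add_le_add ?_ ?_
    · rw [div_eq_mul_inv]
      exact mul_le_mul_of_nonneg_right (le_max_left _ _) (inv_pos.mpr hgap').le
    · have e : 3 * Real.pi * (d + 1 : ℕ) / (2 * s) = (3 * Real.pi * (d + 1 : ℕ) / 2) * (s : ℝ)⁻¹ := by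
        field_simp
      rw [e]
      exact mul_le_mul_of_nonneg_right (le_max_right _ _) (inv_pos.mpr hsr).le
  have hKle : K / (R₀ - R₁) ≤ Λ₀ * (R₀ - R₁)⁻¹ := by
    rw [div_eq_mul_inv]; exact mul_le_mul_of_nonneg_right hΛ₀K (inv_pos.mpr hgap').le
  -- term 1 ≤ spacing·(C·m·E2R·E·F)
  have h1 : m * B₁ ≤ P.spacing k * (C * (m * 1 * E2R) * E * F) := by
    have : B₁ ≤ P.spacing k * (C * E2R * E * F) := by
      rw [hB₁def]
      refine mul_le_mul_of_nonneg_left ?_ hsp0.le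
      have := mul_le_mul (mul_le_mul hC1 (hED le_rfl) (Real.exp_pos _).le hC0) (hE2 le_rfl) (Real.exp_pos _).le (by positivity)
      calc c₀ * Real.exp (-(δ₀ * (((P.L : ℝ) ^ k)⁻¹ * D))) * Real.exp (-(δ₀ * (((P.L : ℝ) ^ k)⁻¹ * (R - 1 + R)))) * F
          ≤ C * E * E2R * F := mul_le_mul_of_nonneg_right this hF0
        _ = C * E2R * E * F := by ring
    calc m * B₁ ≤ m * (P.spacing k * (C * E2R * E * F)) := mul_le_mul_of_nonneg_left this hm0
      _ = P.spacing k * (C * (m * 1 * E2R) * E * F) := by ring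
  -- term 2 ≤ spacing·(C·m·L^k((R₀−R₁)⁻¹ + s⁻¹)·E2R·E·F)
  have h2 : P.eps⁻¹ * (2 * m * B₂) ≤ P.spacing k * (C * (m * ((P.L : ℝ) ^ k * ((R₀ - R₁)⁻¹ + (s : ℝ)⁻¹)) * E2R) * E * F) := by
    have e : P.eps⁻¹ * (2 * m * B₂) = P.spacing k * ((2 * c₀ * Λ) * m * (P.L : ℝ) ^ k *
        (Real.exp (-(δ₀ * (((P.L : ℝ) ^ k)⁻¹ * D))) * Real.exp (-(δ₀ * (((P.L : ℝ) ^ k)⁻¹ * (R - 1 + R))))) * F) := by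
      rw [hB₂def]
      have : P.eps⁻¹ * (2 * m * (P.spacing k ^ 2 * (c₀ * Real.exp (-(δ₀ * (((P.L : ℝ) ^ k)⁻¹ * D))) *
          Real.exp (-(δ₀ * (((P.L : ℝ) ^ k)⁻¹ * (R - 1 + R)))) * (Λ * F)))) =
          (P.eps⁻¹ * P.spacing k ^ 2) * (2 * c₀ * Λ * m *
            (Real.exp (-(δ₀ * (((P.L : ℝ) ^ k)⁻¹ * D))) * Real.exp (-(δ₀ * (((P.L : ℝ) ^ k)⁻¹ * (R - 1 + R))))) * F) := by ring
      rw [this, hscale]; ring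
    rw [e]
    refine mul_le_mul_of_nonneg_left ?_ hsp0.le
    have hcoef : 2 * c₀ * Λ * m * (P.L : ℝ) ^ k ≤ C * (m * ((P.L : ℝ) ^ k * ((R₀ - R₁)⁻¹ + (s : ℝ)⁻¹))) := by
      have h3 : 2 * c₀ * Λ ≤ C * ((R₀ - R₁)⁻¹ + (s : ℝ)⁻¹) := by
        calc 2 * c₀ * Λ ≤ 2 * c₀ * (Λ₀ * ((R₀ - R₁)⁻¹ + (s : ℝ)⁻¹)) := mul_le_mul_of_nonneg_left hΛle (by positivity)
          _ = (2 * c₀ * Λ₀) * ((R₀ - R₁)⁻¹ + (s : ℝ)⁻¹) := by ring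
          _ ≤ C * ((R₀ - R₁)⁻¹ + (s : ℝ)⁻¹) := mul_le_mul_of_nonneg_right (by linarith) (by positivity)
      calc 2 * c₀ * Λ * m * (P.L : ℝ) ^ k = (2 * c₀ * Λ) * (m * (P.L : ℝ) ^ k) := by ring
        _ ≤ (C * ((R₀ - R₁)⁻¹ + (s : ℝ)⁻¹)) * (m * (P.L : ℝ) ^ k) := mul_le_mul_of_nonneg_right h3 (by positivity)
        _ = C * (m * ((P.L : ℝ) ^ k * ((R₀ - R₁)⁻¹ + (s : ℝ)⁻¹))) := by ring
    have hexp : Real.exp (-(δ₀ * (((P.L : ℝ) ^ k)⁻¹ * D))) * Real.exp (-(δ₀ * (((P.L : ℝ) ^ k)⁻¹ * (R - 1 + R)))) ≤ E2R * E := by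
      calc _ ≤ E * E2R := mul_le_mul (hED le_rfl) (hE2 le_rfl) (Real.exp_pos _).le hE0.le
        _ = E2R * E := mul_comm _ _
    calc 2 * c₀ * Λ * m * (P.L : ℝ) ^ k *
          (Real.exp (-(δ₀ * (((P.L : ℝ) ^ k)⁻¹ * D))) * Real.exp (-(δ₀ * (((P.L : ℝ) ^ k)⁻¹ * (R - 1 + R))))) * F
        ≤ C * (m * ((P.L : ℝ) ^ k * ((R₀ - R₁)⁻¹ + (s : ℝ)⁻¹))) * (E2R * E) * F :=
          mul_le_mul_of_nonneg_right (mul_le_mul hcoef hexp (by positivity) (by positivity)) hF0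
      _ = C * (m * ((P.L : ℝ) ^ k * ((R₀ - R₁)⁻¹ + (s : ℝ)⁻¹)) * E2R) * E * F := by ring
  -- term 3 ≤ spacing·(C·1·ER1·E·F)
  have h3 : B₃ ≤ P.spacing k * (C * (1 * ER1) * E * F) := by
    rw [hB₃def]
    refine mul_le_mul_of_nonneg_left ?_ hsp0.le
    calc c₀ * Real.exp (-(δ₀ * (((P.L : ℝ) ^ k)⁻¹ * D'))) * F ≤ C * (E * ER1) * F :=
          mul_le_mul_of_nonneg_right (mul_le_mul hC3 (hED' le_rfl) (Real.exp_pos _).le hC0) hF0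
      _ = C * (1 * ER1) * E * F := by ring
  -- term 4 ≤ spacing·(C·L^k(R₀−R₁)⁻¹·ER1·E·F)
  have h4 : P.eps⁻¹ * B₄ ≤ P.spacing k * (C * ((P.L : ℝ) ^ k * (R₀ - R₁)⁻¹ * ER1) * E * F) := by
    have e : P.eps⁻¹ * B₄ = P.spacing k * ((c₀ * (K / (R₀ - R₁))) * (P.L : ℝ) ^ k * Real.exp (-(δ₀ * (((P.L : ℝ) ^ k)⁻¹ * D'))) * F) := by
      rw [hB₄def]
      have : P.eps⁻¹ * (P.spacing k ^ 2 * (c₀ * Real.exp (-(δ₀ * (((P.L : ℝ) ^ k)⁻¹ * D'))) * (K / (R₀ - R₁) * F))) =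
          (P.eps⁻¹ * P.spacing k ^ 2) * (c₀ * (K / (R₀ - R₁)) * Real.exp (-(δ₀ * (((P.L : ℝ) ^ k)⁻¹ * D'))) * F) := by ring
      rw [this, hscale]; ring
    rw [e]
    refine mul_le_mul_of_nonneg_left ?_ hsp0.le
    have hcoef : c₀ * (K / (R₀ - R₁)) * (P.L : ℝ) ^ k ≤ C * ((P.L : ℝ) ^ k * (R₀ - R₁)⁻¹) := by
      have h5 : c₀ * (K / (R₀ - R₁)) ≤ C * (R₀ - R₁)⁻¹ := by
        calc c₀ * (K / (R₀ - R₁)) ≤ c₀ * (Λ₀ * (R₀ - R₁)⁻¹) := mul_le_mul_of_nonneg_left hKle hc₀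
          _ = (c₀ * Λ₀) * (R₀ - R₁)⁻¹ := by ring
          _ ≤ C * (R₀ - R₁)⁻¹ := mul_le_mul_of_nonneg_right (by linarith) (inv_pos.mpr hgap').le
      calc c₀ * (K / (R₀ - R₁)) * (P.L : ℝ) ^ k ≤ C * (R₀ - R₁)⁻¹ * (P.L : ℝ) ^ k := mul_le_mul_of_nonneg_right h5 hLk.le
        _ = C * ((P.L : ℝ) ^ k * (R₀ - R₁)⁻¹) := by ring
    calc c₀ * (K / (R₀ - R₁)) * (P.L : ℝ) ^ k * Real.exp (-(δ₀ * (((P.L : ℝ) ^ k)⁻¹ * D'))) * F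
        ≤ C * ((P.L : ℝ) ^ k * (R₀ - R₁)⁻¹) * (E * ER1) * F :=
          mul_le_mul_of_nonneg_right (mul_le_mul hcoef (hED' le_rfl) (Real.exp_pos _).le (by positivity)) hF0
      _ = C * ((P.L : ℝ) ^ k * (R₀ - R₁)⁻¹ * ER1) * E * F := by ring
  refine ((norm_add_le _ _).trans (add_le_add ((norm_add_le _ _).trans (add_le_add ((norm_add_le _ _).trans
    (add_le_add hsum1 hsum2)) hterm3)) hterm4)).trans ?_
  calc m * B₁ + P.eps⁻¹ * (2 * m * B₂) + B₃ + P.eps⁻¹ * B₄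
      ≤ P.spacing k * (C * (m * 1 * E2R) * E * F) + P.spacing k * (C * (m * ((P.L : ℝ) ^ k * ((R₀ - R₁)⁻¹ + (s : ℝ)⁻¹)) * E2R) * E * F) +
        P.spacing k * (C * (1 * ER1) * E * F) + P.spacing k * (C * ((P.L : ℝ) ^ k * (R₀ - R₁)⁻¹ * ER1) * E * F) :=
        add_le_add (add_le_add (add_le_add h1 h2) h3) h4
    _ = P.spacing k * (C * (m * (1 + (P.L : ℝ) ^ k * ((R₀ - R₁)⁻¹ + (s : ℝ)⁻¹)) * E2R + (1 + (P.L : ℝ) ^ k * (R₀ - R₁)⁻¹) * ER1) * E * F) := by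
        ring


end

end Literature.MathematicalPhysics.QuantumFieldTheory.BalabanImbrieJaffe1984to88.BIJ88LocDeriv231TorusOfInputs
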